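import Mathlib
import Summits.AtomisticToContinuum.Crystallization.Theorems.SquareWellLayerCakeGapTwelveToBarlowNoSixCommonNeighbours

/-!
# The octahedral-diagonal bound (elementary part of stub `stub_extendedGap` of `GapTwelveToBarlow`)

Crux `SquareWellLayerCake.GapTwelveToBarlow` (item stmt-AtomisticToContinuum-15807), line `Sketch`,
stub `stub_extendedGap` ("tolerant Lemma 2": four-deep inside an all-Good region no two sites are at
distance in `(1, 131/100)`).  This file proves the ELEMENTARY motif exclusion behind the constant
`131/100`: the diagonal of a tolerant octahedron.

`le_dist_of_common_four_cycle`: if two points `p, q` with `1 < |pq|` have four common neighbours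
`a, b, c, d` (all eight distances `|pa|, …, |qd| ∈ [55/57, 1]`) which are pairwise `55/57`-separated
and consecutively bonded (`|ab|, |bc|, |cd|, |da| ≤ 1`), then `|pq| ≥ 131/100`
(the argument works verbatim while `t² < 4·(55/57)² − 2 − 4ε²`, i.e. up to `t ≈ 1.3113`; the
separation `|ad| ≥ 55/57` is not needed).

## Proof

Let `t = |pq| ∈ (1, 131/100)` (for contradiction), `e = (q − p)/t`, and for a point `x` write
`σ_x = ⟪x − p, e⟫`, `P_x = x − p − σ_x e ⊥ e`.  For a common neighbour `x` the two squared distances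
`|x − p|² = |P_x|² + σ_x²`, `|x − q|² = |P_x|² + (σ_x − t)²` lie in `[(55/57)², 1]`, whence
`|σ_x − t/2| ≤ ε := (1 − (55/57)²)/2` and `L(t) := (55/57)² − t²/4 − ε² ≤ |P_x|² ≤ 1 − t²/4`
(`ring_point_window`).  For two common neighbours `|x − y|² = |P_x − P_y|² + (σ_x − σ_y)²`, so a bond
`|x − y| ≤ 1` forces `⟪P_x, P_y⟫ > 0` as long as `2 L(t) > 1`, i.e. `t < 1.3113`
(`consecutive_inner_pos`), while separation `|x − y| ≥ 55/57` forces `⟪P_x, P_y⟫ ≤ U(t)` with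
`2 U(t)² < L(t)²` (`inner_le_U`, `two_U_sq_lt_L_sq`).  The four transversal parts live in the plane
`e^⊥ ≅ ℂ` (`OrthonormalBasis.fromOrthogonalSpanSingleton` + `Complex.isometryOfOrthonormal`), and
in the plane this is impossible (`planar_four_cycle_false`): four vectors with consecutive inner
products `> 0` have a diagonal pair with inner product `≥ 0` (`[x,y][x,z] > 0`-bookkeeping with the
identity `|x|²⟪y,z⟫ = ⟪x,y⟫⟪x,z⟫ + [x,y][x,z]`), and three plane vectors with pairwise inner products
`≥ 0` and pairwise `⟪·,·⟫² < [·,·]²` (angles `> 45°`) do not exist (`planar_three_false`).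

Mathlib + the landed `norm_add_smul_sq_of_inner_eq_zero` (NoSixCommonNeighbours); no named fact is used.
-/

noncomputable section

namespace Summit.AtomisticToContinuum.Crystallization.Theorems.SquareWellLayerCakeGapTwelveToBarlow

open scoped InnerProductSpace ComplexConjugate Real

/-! ## Planar part -/

/-- If `P² < Q²`, `Q < 0` and `R = P + Q` then `R < 0`; used with `R = |x|²⟪y,z⟫ ≥ 0`. [folklore] -/
theorem neg_bracket_dominates {P Q R : ℝ} (h : P ^ 2 < Q ^ 2) (hQ : Q < 0) (hR : 0 ≤ R)
    (hI : R = P + Q) : False := by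
  have hPQ : |P| < |Q| := sq_lt_sq.mp h
  rw [abs_of_neg hQ] at hPQ
  linarith [le_abs_self P]

/-- **Three plane vectors with pairwise non-negative inner products cannot pairwise make angles
above `45°`.**  Hypotheses: `⟪x,y⟫, ⟪x,z⟫, ⟪y,z⟫ ≥ 0` and `⟪·,·⟫² < [·,·]²` for the three pairs
(`[x,y] = x₁y₂ − x₂y₁`).  The identities `|x|²⟪y,z⟫ = ⟪x,y⟫⟪x,z⟫ + [x,y][x,z]`,
`|y|²⟪x,z⟫ = ⟪x,y⟫⟪y,z⟫ − [x,y][y,z]`, `|z|²⟪x,y⟫ = ⟪x,z⟫⟪y,z⟫ + [x,z][y,z]` have bracket terms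
whose product is `−([x,y][x,z][y,z])² < 0`; the negative one dominates its companion. [folklore] -/
theorem planar_three_false (x₁ x₂ y₁ y₂ z₁ z₂ : ℝ)
    (hxy : 0 ≤ x₁ * y₁ + x₂ * y₂) (hxz : 0 ≤ x₁ * z₁ + x₂ * z₂) (hyz : 0 ≤ y₁ * z₁ + y₂ * z₂)
    (bxy : (x₁ * y₁ + x₂ * y₂) ^ 2 < (x₁ * y₂ - x₂ * y₁) ^ 2)
    (bxz : (x₁ * z₁ + x₂ * z₂) ^ 2 < (x₁ * z₂ - x₂ * z₁) ^ 2)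
    (byz : (y₁ * z₁ + y₂ * z₂) ^ 2 < (y₁ * z₂ - y₂ * z₁) ^ 2) : False := by
  have I1 : (x₁ ^ 2 + x₂ ^ 2) * (y₁ * z₁ + y₂ * z₂) =
      (x₁ * y₁ + x₂ * y₂) * (x₁ * z₁ + x₂ * z₂) + (x₁ * y₂ - x₂ * y₁) * (x₁ * z₂ - x₂ * z₁) := by
    ring
  have I2 : (y₁ ^ 2 + y₂ ^ 2) * (x₁ * z₁ + x₂ * z₂) =
      (x₁ * y₁ + x₂ * y₂) * (y₁ * z₁ + y₂ * z₂) + -((x₁ * y₂ - x₂ * y₁) * (y₁ * z₂ - y₂ * z₁)) := by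
    ring
  have I3 : (z₁ ^ 2 + z₂ ^ 2) * (x₁ * y₁ + x₂ * y₂) =
      (x₁ * z₁ + x₂ * z₂) * (y₁ * z₁ + y₂ * z₂) + (x₁ * z₂ - x₂ * z₁) * (y₁ * z₂ - y₂ * z₁) := by
    ring
  have R1 : 0 ≤ (x₁ ^ 2 + x₂ ^ 2) * (y₁ * z₁ + y₂ * z₂) := mul_nonneg (by positivity) hyz
  have R2 : 0 ≤ (y₁ ^ 2 + y₂ ^ 2) * (x₁ * z₁ + x₂ * z₂) := mul_nonneg (by positivity) hxz
  have R3 : 0 ≤ (z₁ ^ 2 + z₂ ^ 2) * (x₁ * y₁ + x₂ * y₂) := mul_nonneg (by positivity) hxy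
  -- squares of the products
  have S1 : ((x₁ * y₁ + x₂ * y₂) * (x₁ * z₁ + x₂ * z₂)) ^ 2 <
      ((x₁ * y₂ - x₂ * y₁) * (x₁ * z₂ - x₂ * z₁)) ^ 2 := by
    rw [mul_pow, mul_pow]; exact mul_lt_mul'' bxy bxz (sq_nonneg _) (sq_nonneg _)
  have S2 : ((x₁ * y₁ + x₂ * y₂) * (y₁ * z₁ + y₂ * z₂)) ^ 2 <
      (-((x₁ * y₂ - x₂ * y₁) * (y₁ * z₂ - y₂ * z₁))) ^ 2 := by
    rw [neg_sq, mul_pow, mul_pow]; exact mul_lt_mul'' bxy byz (sq_nonneg _) (sq_nonneg _)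
  have S3 : ((x₁ * z₁ + x₂ * z₂) * (y₁ * z₁ + y₂ * z₂)) ^ 2 <
      ((x₁ * z₂ - x₂ * z₁) * (y₁ * z₂ - y₂ * z₁)) ^ 2 := by
    rw [mul_pow, mul_pow]; exact mul_lt_mul'' bxz byz (sq_nonneg _) (sq_nonneg _)
  -- the brackets are nonzero
  have nxy : x₁ * y₂ - x₂ * y₁ ≠ 0 := fun h => by rw [h] at bxy; nlinarith [sq_nonneg (x₁ * y₁ + x₂ * y₂)]
  have nxz : x₁ * z₂ - x₂ * z₁ ≠ 0 := fun h => by rw [h] at bxz; nlinarith [sq_nonneg (x₁ * z₁ + x₂ * z₂)]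
  have nyz : y₁ * z₂ - y₂ * z₁ ≠ 0 := fun h => by rw [h] at byz; nlinarith [sq_nonneg (y₁ * z₁ + y₂ * z₂)]
  rcases lt_or_gt_of_ne nxy with sxy | sxy <;> rcases lt_or_gt_of_ne nxz with sxz | sxz <;>
    rcases lt_or_gt_of_ne nyz with syz | syz
  · -- (-,-,-): Q2 < 0
    exact neg_bracket_dominates S2 (neg_lt_zero.mpr (mul_pos_of_neg_of_neg sxy syz)) R2 I2
  · -- (-,-,+): Q3 < 0
    exact neg_bracket_dominates S3 (mul_neg_of_neg_of_pos sxz syz) R3 I3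
  · -- (-,+,-): Q1 < 0
    exact neg_bracket_dominates S1 (mul_neg_of_neg_of_pos sxy sxz) R1 I1
  · -- (-,+,+): Q1 < 0
    exact neg_bracket_dominates S1 (mul_neg_of_neg_of_pos sxy sxz) R1 I1
  · -- (+,-,-): Q1 < 0
    exact neg_bracket_dominates S1 (mul_neg_of_pos_of_neg sxy sxz) R1 I1
  · -- (+,-,+): Q1 < 0
    exact neg_bracket_dominates S1 (mul_neg_of_pos_of_neg sxy sxz) R1 I1
  · -- (+,+,-): Q3 < 0
    exact neg_bracket_dominates S3 (mul_neg_of_pos_of_neg sxz syz) R3 I3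
  · -- (+,+,+): Q2 < 0
    exact neg_bracket_dominates S2 (neg_lt_zero.mpr (mul_pos sxy syz)) R2 I2

/-- Lagrange in the plane turns `0 ≤ ⟪x,y⟫ ≤ U`, `|x|², |y|² ≥ L`, `2U² < L²` into
`⟪x,y⟫² < [x,y]²`. [folklore] -/
theorem bracket_dominates {L U n m ip br : ℝ} (hL : 0 < L) (hUL : 2 * U ^ 2 < L ^ 2)
    (hn : L ≤ n) (hm : L ≤ m) (h0 : 0 ≤ ip) (hU : ip ≤ U) (lag : ip ^ 2 + br ^ 2 = n * m) :
    ip ^ 2 < br ^ 2 := by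
  have h1 : L ^ 2 ≤ n * m := by nlinarith
  have h2 : ip ^ 2 ≤ U ^ 2 := pow_le_pow_left₀ h0 hU 2
  nlinarith

/-- **Four plane vectors `x → y → z → w → x` with consecutive inner products `> 0`, all squared
norms `≥ L > 0` and all pairwise inner products `≤ U` with `2U² < L²` do not exist.**  If the
diagonal `⟪x,z⟫ ≥ 0`, the triple `x, y, z` contradicts `planar_three_false`; if `⟪x,z⟫ < 0`, the
identities `|x|²⟪y,z⟫ = ⟪x,y⟫⟪x,z⟫ + [x,y][x,z]` (and for `(z,w)`, `(y,w)`) give `[x,y][x,z] > 0`,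
`[x,z][x,w] > 0`, hence `[x,y][x,w] > 0` and `⟪y,w⟫ > 0`, and the triple `y, z, w` contradicts
`planar_three_false`. [folklore] -/
theorem planar_four_cycle_false (x₁ x₂ y₁ y₂ z₁ z₂ w₁ w₂ L U : ℝ) (hL : 0 < L)
    (hUL : 2 * U ^ 2 < L ^ 2)
    (nx : L ≤ x₁ ^ 2 + x₂ ^ 2) (ny : L ≤ y₁ ^ 2 + y₂ ^ 2) (nz : L ≤ z₁ ^ 2 + z₂ ^ 2)
    (nw : L ≤ w₁ ^ 2 + w₂ ^ 2)
    (cxy : 0 < x₁ * y₁ + x₂ * y₂) (cyz : 0 < y₁ * z₁ + y₂ * z₂) (czw : 0 < z₁ * w₁ + z₂ * w₂)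
    (cxw : 0 < x₁ * w₁ + x₂ * w₂)
    (uxy : x₁ * y₁ + x₂ * y₂ ≤ U) (uxz : x₁ * z₁ + x₂ * z₂ ≤ U) (uyz : y₁ * z₁ + y₂ * z₂ ≤ U)
    (uyw : y₁ * w₁ + y₂ * w₂ ≤ U) (uzw : z₁ * w₁ + z₂ * w₂ ≤ U) : False := by
  have lag : ∀ a₁ a₂ b₁ b₂ : ℝ, (a₁ * b₁ + a₂ * b₂) ^ 2 + (a₁ * b₂ - a₂ * b₁) ^ 2 =
      (a₁ ^ 2 + a₂ ^ 2) * (b₁ ^ 2 + b₂ ^ 2) := fun _ _ _ _ => by ring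
  rcases le_or_gt 0 (x₁ * z₁ + x₂ * z₂) with hxz | hxz
  · exact planar_three_false x₁ x₂ y₁ y₂ z₁ z₂ cxy.le hxz cyz.le
      (bracket_dominates hL hUL nx ny cxy.le uxy (lag _ _ _ _))
      (bracket_dominates hL hUL nx nz hxz uxz (lag _ _ _ _))
      (bracket_dominates hL hUL ny nz cyz.le uyz (lag _ _ _ _))
  · have nx0 : 0 < x₁ ^ 2 + x₂ ^ 2 := lt_of_lt_of_le hL nx
    have I1 : (x₁ ^ 2 + x₂ ^ 2) * (y₁ * z₁ + y₂ * z₂) =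
        (x₁ * y₁ + x₂ * y₂) * (x₁ * z₁ + x₂ * z₂) + (x₁ * y₂ - x₂ * y₁) * (x₁ * z₂ - x₂ * z₁) := by
      ring
    have I2 : (x₁ ^ 2 + x₂ ^ 2) * (z₁ * w₁ + z₂ * w₂) =
        (x₁ * z₁ + x₂ * z₂) * (x₁ * w₁ + x₂ * w₂) + (x₁ * z₂ - x₂ * z₁) * (x₁ * w₂ - x₂ * w₁) := by
      ring
    have I3 : (x₁ ^ 2 + x₂ ^ 2) * (y₁ * w₁ + y₂ * w₂) =
        (x₁ * y₁ + x₂ * y₂) * (x₁ * w₁ + x₂ * w₂) + (x₁ * y₂ - x₂ * y₁) * (x₁ * w₂ - x₂ * w₁) := by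
      ring
    have h1 : 0 < (x₁ * y₂ - x₂ * y₁) * (x₁ * z₂ - x₂ * z₁) := by
      nlinarith [mul_pos nx0 cyz, mul_neg_of_pos_of_neg cxy hxz]
    have h2 : 0 < (x₁ * z₂ - x₂ * z₁) * (x₁ * w₂ - x₂ * w₁) := by
      nlinarith [mul_pos nx0 czw, mul_neg_of_neg_of_pos hxz cxw]
    have h3 : 0 < (x₁ * y₂ - x₂ * y₁) * (x₁ * w₂ - x₂ * w₁) := by
      rcases pos_and_pos_or_neg_and_neg_of_mul_pos h1 with ⟨ha, hb⟩ | ⟨ha, hb⟩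
      · exact mul_pos ha (pos_of_mul_pos_right h2 hb.le)
      · have hc : x₁ * w₂ - x₂ * w₁ < 0 := by
          by_contra! hc
          nlinarith [mul_nonpos_iff.mpr (Or.inr ⟨hb.le, hc⟩)]
        exact mul_pos_of_neg_of_neg ha hc
    have hyw : 0 < y₁ * w₁ + y₂ * w₂ := by
      have : 0 < (x₁ ^ 2 + x₂ ^ 2) * (y₁ * w₁ + y₂ * w₂) := by
        rw [I3]; exact add_pos (mul_pos cxy cxw) h3
      exact pos_of_mul_pos_right this nx0.le
    exact planar_three_false y₁ y₂ z₁ z₂ w₁ w₂ cyz.le hyw.le czw.le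
      (bracket_dominates hL hUL ny nz cyz.le uyz (lag _ _ _ _))
      (bracket_dominates hL hUL ny nw hyw.le uyw (lag _ _ _ _))
      (bracket_dominates hL hUL nz nw czw.le uzw (lag _ _ _ _))

/-! ## Metric part: windows for a common neighbour of `p` and `q` -/

/-- Window of a common neighbour: if `A = ρ² + σ²` and `B = ρ² + (σ − t)²` both lie in
`[(55/57)², 1]` and `1 < t`, then `(σ − t/2)² ≤ ε²` with `ε = (1 − (55/57)²)/2`, and
`(55/57)² − t²/4 − ε² ≤ ρ² ≤ 1 − t²/4`. [folklore] -/
theorem ring_point_window {t A B ρ2 σ : ℝ} (ht1 : 1 < t)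
    (hA1 : (55 / 57 : ℝ) ^ 2 ≤ A) (hA2 : A ≤ 1) (hB1 : (55 / 57 : ℝ) ^ 2 ≤ B) (hB2 : B ≤ 1)
    (hA : A = ρ2 + σ ^ 2) (hB : B = ρ2 + (σ - t) ^ 2) :
    (σ - t / 2) ^ 2 ≤ ((1 - (55 / 57 : ℝ) ^ 2) / 2) ^ 2 ∧
      (55 / 57 : ℝ) ^ 2 - t ^ 2 / 4 - ((1 - (55 / 57 : ℝ) ^ 2) / 2) ^ 2 ≤ ρ2 ∧
      ρ2 ≤ 1 - t ^ 2 / 4 := by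
  have key : 2 * t * (σ - t / 2) = A - B := by rw [hA, hB]; ring
  have hρ : ρ2 = (A + B) / 2 - t ^ 2 / 4 - (σ - t / 2) ^ 2 := by rw [hA, hB]; ring
  have habs : |σ - t / 2| ≤ (1 - (55 / 57 : ℝ) ^ 2) / 2 := by
    have h2t : 0 < 2 * t := by linarith
    have h1 : |2 * t * (σ - t / 2)| ≤ 1 - (55 / 57 : ℝ) ^ 2 := by
      rw [key, abs_le]; constructor <;> linarith
    rw [abs_mul, abs_of_pos h2t] at h1
    have hnn := abs_nonneg (σ - t / 2)
    nlinarith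
  have h1 : (σ - t / 2) ^ 2 ≤ ((1 - (55 / 57 : ℝ) ^ 2) / 2) ^ 2 := by
    have := abs_le.mp habs
    exact sq_le_sq' (by linarith) this.2
  refine ⟨h1, ?_, ?_⟩
  · rw [hρ]; nlinarith
  · rw [hρ]; nlinarith [sq_nonneg (σ - t / 2)]

/-- Two axial coordinates within `ε` of `t/2` differ by at most `2ε` (squared form). [folklore] -/
theorem axial_diff_sq_le_four {σ σ' t ε2 : ℝ} (h : (σ - t / 2) ^ 2 ≤ ε2) (h' : (σ' - t / 2) ^ 2 ≤ ε2) :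
    (σ - σ') ^ 2 ≤ 4 * ε2 := by
  nlinarith [sq_nonneg ((σ - t / 2) + (σ' - t / 2))]

/-- A bonded pair of common neighbours has transversal parts at a positive inner product while
`t < 131/100`: `2⟪P,P'⟫ = ρ² + ρ'² − D + (σ − σ')² ≥ 2L(t) − 1 > 0`. [folklore] -/
theorem consecutive_inner_pos {t ρ ρ' D ip dσ2 : ℝ} (ht1 : 1 < t) (ht2 : t < 131 / 100)
    (hρ : (55 / 57 : ℝ) ^ 2 - t ^ 2 / 4 - ((1 - (55 / 57 : ℝ) ^ 2) / 2) ^ 2 ≤ ρ)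
    (hρ' : (55 / 57 : ℝ) ^ 2 - t ^ 2 / 4 - ((1 - (55 / 57 : ℝ) ^ 2) / 2) ^ 2 ≤ ρ')
    (hD : D ≤ 1) (hdσ : 0 ≤ dσ2) (hip : 2 * ip = ρ + ρ' - D + dσ2) : 0 < ip := by
  have ht : t ^ 2 < (131 / 100 : ℝ) ^ 2 := by nlinarith
  nlinarith

/-- A separated pair of common neighbours has `⟪P,P'⟫ ≤ U(t) = 1 − t²/4 − (55/57)²/2 + 2ε²`.
[folklore] -/
theorem inner_le_U {t ρ ρ' D ip dσ2 : ℝ}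
    (hρ : ρ ≤ 1 - t ^ 2 / 4) (hρ' : ρ' ≤ 1 - t ^ 2 / 4) (hD : (55 / 57 : ℝ) ^ 2 ≤ D)
    (hdσ : dσ2 ≤ 4 * ((1 - (55 / 57 : ℝ) ^ 2) / 2) ^ 2) (hip : 2 * ip = ρ + ρ' - D + dσ2) :
    ip ≤ 1 - t ^ 2 / 4 - (55 / 57 : ℝ) ^ 2 / 2 + 2 * ((1 - (55 / 57 : ℝ) ^ 2) / 2) ^ 2 := by
  linarith

/-- The numerical heart: `0 < L(t)` and `2U(t)² < L(t)²` for `1 < t < 131/100`. [folklore] -/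
theorem two_U_sq_lt_L_sq {t : ℝ} (ht1 : 1 < t) (ht2 : t < 131 / 100) :
    0 < (55 / 57 : ℝ) ^ 2 - t ^ 2 / 4 - ((1 - (55 / 57 : ℝ) ^ 2) / 2) ^ 2 ∧
    2 * (1 - t ^ 2 / 4 - (55 / 57 : ℝ) ^ 2 / 2 + 2 * ((1 - (55 / 57 : ℝ) ^ 2) / 2) ^ 2) ^ 2 <
      ((55 / 57 : ℝ) ^ 2 - t ^ 2 / 4 - ((1 - (55 / 57 : ℝ) ^ 2) / 2) ^ 2) ^ 2 := by
  have ht : t ^ 2 < (131 / 100 : ℝ) ^ 2 := by nlinarith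
  have ht0 : 1 < t ^ 2 := by nlinarith
  constructor
  · nlinarith
  · nlinarith [mul_lt_mul_of_pos_left ht (show (0 : ℝ) < t ^ 2 by positivity)]

/-! ## The octahedral diagonal -/

/-- **Octahedral-diagonal bound (tolerant octahedron).**  Two points `p, q` of `ℝ³` with
`1 < |pq|` whose four common neighbours `a, b, c, d` (all of `|pa|, …, |qd| ∈ [55/57, 1]`) are
pairwise `55/57`-separated and consecutively bonded (`|ab|, |bc|, |cd|, |da| ≤ 1`) satisfy
`131/100 ≤ |pq|`: in an all-Good region (bonds `∈ [55/57, 1]`, nothing in `(1, 11/10]`) the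
diagonal of every octahedral motif is at least `1.31` (indeed `≥ 1.3113`).  This is the `T/O`
value of the extended-gap constant of `stub_extendedGap`. [folklore] -/
theorem le_dist_of_common_four_cycle (p q a b c d : EuclideanSpace ℝ (Fin 3))
    (hpq : 1 < dist p q)
    (hpa : dist p a ≤ 1) (hpb : dist p b ≤ 1) (hpc : dist p c ≤ 1) (hpd : dist p d ≤ 1)
    (hqa : dist q a ≤ 1) (hqb : dist q b ≤ 1) (hqc : dist q c ≤ 1) (hqd : dist q d ≤ 1)
    (lpa : 55 / 57 ≤ dist p a) (lpb : 55 / 57 ≤ dist p b) (lpc : 55 / 57 ≤ dist p c)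
    (lpd : 55 / 57 ≤ dist p d) (lqa : 55 / 57 ≤ dist q a) (lqb : 55 / 57 ≤ dist q b)
    (lqc : 55 / 57 ≤ dist q c) (lqd : 55 / 57 ≤ dist q d)
    (hab : dist a b ≤ 1) (hbc : dist b c ≤ 1) (hcd : dist c d ≤ 1) (hda : dist d a ≤ 1)
    (lab : 55 / 57 ≤ dist a b) (lac : 55 / 57 ≤ dist a c) (lbc : 55 / 57 ≤ dist b c)
    (lbd : 55 / 57 ≤ dist b d) (lcd : 55 / 57 ≤ dist c d) :
    131 / 100 ≤ dist p q := by
  by_contra! hlt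
  -- the axis
  obtain ⟨t, ht⟩ : ∃ t : ℝ, t = dist p q := ⟨_, rfl⟩
  rw [← ht] at hpq hlt
  have htpos : 0 < t := by linarith
  have hnorm_qp : ‖q - p‖ = t := by rw [ht, dist_eq_norm, norm_sub_rev]
  obtain ⟨e, he⟩ : ∃ e : EuclideanSpace ℝ (Fin 3), e = t⁻¹ • (q - p) := ⟨_, rfl⟩
  have he1 : ‖e‖ = 1 := by
    rw [he, norm_smul, norm_inv, Real.norm_eq_abs, abs_of_pos htpos, hnorm_qp,
      inv_mul_cancel₀ htpos.ne']
  have hee : ⟪e, e⟫_ℝ = 1 := by rw [real_inner_self_eq_norm_sq, he1, one_pow]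
  have hqp : q - p = t • e := by rw [he, smul_smul, mul_inv_cancel₀ htpos.ne', one_smul]
  -- axial coordinates `σ` and transversal parts `P`
  obtain ⟨σ, hσ⟩ : ∃ σ : EuclideanSpace ℝ (Fin 3) → ℝ, ∀ x, σ x = ⟪x - p, e⟫_ℝ :=
    ⟨_, fun _ => rfl⟩
  obtain ⟨P, hP⟩ : ∃ P : EuclideanSpace ℝ (Fin 3) → EuclideanSpace ℝ (Fin 3),
      ∀ x, P x = x - p - σ x • e := ⟨_, fun _ => rfl⟩
  have hPe : ∀ x, ⟪P x, e⟫_ℝ = 0 := by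
    intro x
    rw [hP, inner_sub_left, real_inner_smul_left, hee, ← hσ x]
    ring
  have hxp : ∀ x, x - p = P x + σ x • e := by
    intro x
    rw [hP, sub_add_cancel]
  have hxq : ∀ x, x - q = P x + (σ x - t) • e := by
    intro x
    rw [hP, sub_smul, ← hqp]
    abel
  have hxy : ∀ x y, x - y = (P x - P y) + (σ x - σ y) • e := by
    intro x y
    rw [hP, hP, sub_smul]
    abel
  have hA : ∀ x, ‖x - p‖ ^ 2 = ‖P x‖ ^ 2 + σ x ^ 2 := by
    intro x
    rw [hxp]
    exact norm_add_smul_sq_of_inner_eq_zero he1 (hPe x) _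
  have hB : ∀ x, ‖x - q‖ ^ 2 = ‖P x‖ ^ 2 + (σ x - t) ^ 2 := by
    intro x
    rw [hxq]
    exact norm_add_smul_sq_of_inner_eq_zero he1 (hPe x) _
  have hD : ∀ x y, ‖x - y‖ ^ 2 = ‖P x - P y‖ ^ 2 + (σ x - σ y) ^ 2 := by
    intro x y
    rw [hxy]
    exact norm_add_smul_sq_of_inner_eq_zero he1 (by rw [inner_sub_left, hPe, hPe, sub_zero]) _
  -- squared-distance windows
  have hsq : ∀ r : ℝ, 55 / 57 ≤ r → r ≤ 1 → (55 / 57 : ℝ) ^ 2 ≤ r ^ 2 ∧ r ^ 2 ≤ 1 :=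
    fun r h1 h2 => ⟨pow_le_pow_left₀ (by norm_num) h1 2, pow_le_one₀ (by linarith) h2⟩
  have hdn : ∀ x y : EuclideanSpace ℝ (Fin 3), dist y x = ‖x - y‖ := fun x y => by
    rw [dist_eq_norm, norm_sub_rev]
  -- windows of the four common neighbours
  have win : ∀ x, 55 / 57 ≤ dist p x → dist p x ≤ 1 → 55 / 57 ≤ dist q x → dist q x ≤ 1 →
      (σ x - t / 2) ^ 2 ≤ ((1 - (55 / 57 : ℝ) ^ 2) / 2) ^ 2 ∧
      (55 / 57 : ℝ) ^ 2 - t ^ 2 / 4 - ((1 - (55 / 57 : ℝ) ^ 2) / 2) ^ 2 ≤ ‖P x‖ ^ 2 ∧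
      ‖P x‖ ^ 2 ≤ 1 - t ^ 2 / 4 := by
    intro x l1 h1 l2 h2
    rw [hdn] at l1 h1 l2 h2
    obtain ⟨hA1, hA2⟩ := hsq _ l1 h1
    obtain ⟨hB1, hB2⟩ := hsq _ l2 h2
    exact ring_point_window hpq hA1 hA2 hB1 hB2 (hA x) (hB x)
  obtain ⟨wa1, wa2, wa3⟩ := win a lpa hpa lqa hqa
  obtain ⟨wb1, wb2, wb3⟩ := win b lpb hpb lqb hqb
  obtain ⟨wc1, wc2, wc3⟩ := win c lpc hpc lqc hqc
  obtain ⟨wd1, wd2, wd3⟩ := win d lpd hpd lqd hqd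
  -- inner products of transversal parts
  have hip : ∀ x y, 2 * ⟪P x, P y⟫_ℝ = ‖P x‖ ^ 2 + ‖P y‖ ^ 2 - ‖x - y‖ ^ 2 + (σ x - σ y) ^ 2 := by
    intro x y
    rw [hD x y, norm_sub_sq_real]
    ring
  have cons : ∀ x y, dist x y ≤ 1 →
      (55 / 57 : ℝ) ^ 2 - t ^ 2 / 4 - ((1 - (55 / 57 : ℝ) ^ 2) / 2) ^ 2 ≤ ‖P x‖ ^ 2 →
      (55 / 57 : ℝ) ^ 2 - t ^ 2 / 4 - ((1 - (55 / 57 : ℝ) ^ 2) / 2) ^ 2 ≤ ‖P y‖ ^ 2 →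
      0 < ⟪P x, P y⟫_ℝ := by
    intro x y h wx wy
    have h1 : ‖x - y‖ ^ 2 ≤ 1 := by
      rw [← dist_eq_norm]; exact pow_le_one₀ dist_nonneg h
    exact consecutive_inner_pos hpq hlt wx wy h1 (sq_nonneg _) (hip x y)
  have sep : ∀ x y, 55 / 57 ≤ dist x y →
      (σ x - t / 2) ^ 2 ≤ ((1 - (55 / 57 : ℝ) ^ 2) / 2) ^ 2 →
      (σ y - t / 2) ^ 2 ≤ ((1 - (55 / 57 : ℝ) ^ 2) / 2) ^ 2 →
      ‖P x‖ ^ 2 ≤ 1 - t ^ 2 / 4 → ‖P y‖ ^ 2 ≤ 1 - t ^ 2 / 4 →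
      ⟪P x, P y⟫_ℝ ≤ 1 - t ^ 2 / 4 - (55 / 57 : ℝ) ^ 2 / 2 + 2 * ((1 - (55 / 57 : ℝ) ^ 2) / 2) ^ 2 := by
    intro x y h sx sy wx wy
    have h1 : (55 / 57 : ℝ) ^ 2 ≤ ‖x - y‖ ^ 2 := by
      rw [← dist_eq_norm]; exact pow_le_pow_left₀ (by norm_num) h 2
    exact inner_le_U wx wy h1 (axial_diff_sq_le_four sx sy) (hip x y)
  have cab := cons a b hab wa2 wb2
  have cbc := cons b c hbc wb2 wc2
  have ccd := cons c d hcd wc2 wd2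
  have cad : 0 < ⟪P a, P d⟫_ℝ := by rw [real_inner_comm]; exact cons d a hda wd2 wa2
  have uab := sep a b lab wa1 wb1 wa3 wb3
  have uac := sep a c lac wa1 wc1 wa3 wc3
  have ubc := sep b c lbc wb1 wc1 wb3 wc3
  have ubd := sep b d lbd wb1 wd1 wb3 wd3
  have ucd := sep c d lcd wc1 wd1 wc3 wd3
  obtain ⟨hL, hUL⟩ := two_U_sq_lt_L_sq hpq hlt
  -- the plane `e^⊥` is isometric to `ℂ`
  have he0 : e ≠ 0 := fun h => by
    rw [h, norm_zero] at he1
    exact zero_ne_one he1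
  haveI : Fact (Module.finrank ℝ (EuclideanSpace ℝ (Fin 3)) = 2 + 1) :=
    ⟨by rw [finrank_euclideanSpace_fin]⟩
  let Φ : (ℝ ∙ e)ᗮ ≃ₗᵢ[ℝ] ℂ :=
    (Complex.isometryOfOrthonormal (OrthonormalBasis.fromOrthogonalSpanSingleton 2 he0)).symm
  have hmemK : ∀ x, P x ∈ (ℝ ∙ e)ᗮ := fun x =>
    Submodule.mem_orthogonal_singleton_iff_inner_left.mpr (hPe x)
  let z : EuclideanSpace ℝ (Fin 3) → ℂ := fun x => Φ ⟨P x, hmemK x⟩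
  have hzn : ∀ x, (z x).re ^ 2 + (z x).im ^ 2 = ‖P x‖ ^ 2 := by
    intro x
    have h1 : ‖z x‖ = ‖P x‖ := by
      show ‖Φ ⟨P x, hmemK x⟩‖ = ‖P x‖
      rw [LinearIsometryEquiv.norm_map, Submodule.coe_norm, Submodule.coe_mk]
    rw [← h1, Complex.sq_norm, Complex.normSq_apply]
    ring
  have hzi : ∀ x y, (z x).re * (z y).re + (z x).im * (z y).im = ⟪P x, P y⟫_ℝ := by
    intro x y
    have h1 : ⟪z x, z y⟫_ℝ = ⟪P x, P y⟫_ℝ := by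
      show ⟪Φ ⟨P x, hmemK x⟩, Φ ⟨P y, hmemK y⟩⟫_ℝ = ⟪P x, P y⟫_ℝ
      rw [LinearIsometryEquiv.inner_map_map, Submodule.coe_inner, Submodule.coe_mk,
        Submodule.coe_mk]
    rw [← h1, Complex.inner, Complex.mul_re, Complex.conj_re, Complex.conj_im]
    ring
  -- conclude in the plane
  refine planar_four_cycle_false (z a).re (z a).im (z b).re (z b).im (z c).re (z c).im
    (z d).re (z d).im _ _ hL hUL ?_ ?_ ?_ ?_ ?_ ?_ ?_ ?_ ?_ ?_ ?_ ?_ ?_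
  · rw [hzn]; exact wa2
  · rw [hzn]; exact wb2
  · rw [hzn]; exact wc2
  · rw [hzn]; exact wd2
  · rw [hzi]; exact cab
  · rw [hzi]; exact cbc
  · rw [hzi]; exact ccd
  · rw [hzi]; exact cad
  · rw [hzi]; exact uab
  · rw [hzi]; exact uac
  · rw [hzi]; exact ubc
  · rw [hzi]; exact ubd
  · rw [hzi]; exact ucd


/-- Registered closed form of `le_dist_of_common_four_cycle` (octahedral motif of
`stub_extendedGap`: a non-bonded pair with a bonded 4-cycle of common neighbours is `≥ 131/100` apart). [folklore] -/
theorem stub_fourCycleGap :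
    ∀ p q a b c d : EuclideanSpace ℝ (Fin 3), 1 < dist p q →
      dist p a ≤ 1 → dist p b ≤ 1 → dist p c ≤ 1 → dist p d ≤ 1 →
      dist q a ≤ 1 → dist q b ≤ 1 → dist q c ≤ 1 → dist q d ≤ 1 →
      55 / 57 ≤ dist p a → 55 / 57 ≤ dist p b → 55 / 57 ≤ dist p c → 55 / 57 ≤ dist p d →
      55 / 57 ≤ dist q a → 55 / 57 ≤ dist q b → 55 / 57 ≤ dist q c → 55 / 57 ≤ dist q d →
      dist a b ≤ 1 → dist b c ≤ 1 → dist c d ≤ 1 → dist d a ≤ 1 →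
      55 / 57 ≤ dist a b → 55 / 57 ≤ dist a c → 55 / 57 ≤ dist b c → 55 / 57 ≤ dist b d →
      55 / 57 ≤ dist c d → 131 / 100 ≤ dist p q :=
  le_dist_of_common_four_cycle

end Summit.AtomisticToContinuum.Crystallization.Theorems.SquareWellLayerCakeGapTwelveToBarlow
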